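import Literature.Analysis.FluidPDE.LerayProfileCalculus
import Literature.Analysis.FluidPDE.TsaiHeadPressure
import Literature.Analysis.FluidPDE.NewtonKernel
import HarnessLib

/-!
# Route CoriolisHead · crux `CounterRotatingLiouville` (stmt-NavierStokesRegularity-22677) —
# pointwise calculus for the rotated Leray profile system

Support file of the line `tsai-rotating-head-chain` (theorems only; no definitions, no named
facts; `--supports stmt-NavierStokesRegularity-22677`).  NS regularity is NOT proved here.  The **rotated
(backward self-similar) Leray profile system** of Pineau–Vicol (arXiv:2607.09619, (1.8a)–(1.8b),
with the rotation generator `αJ` replaced by a general skew `B`) reads, for `ν, a ∈ ℝ`, a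
continuous linear `B : E →L[ℝ] E`, `U : E → E`, `P : E → ℝ`,

`−νΔU + aU + a(y·∇)U + (BU − (By·∇)U) + (U·∇)U + ∇P = 0`, `div U = 0`

(`B = 0` is Leray's system, Tsai 1998 (1.3), the tree's `IsLerayProfile`).  It is the profile
system of the ansatz `u(x,t) = λ e^{−θB} U(λ e^{θB} x)`, `λ = (2a(T−t))^{-1/2}`,
`θ = −(2a)⁻¹ log (2a(T − t))`.  The hypotheses are carried explicitly (no structure is
introduced).  Proved here, verbatim ports of the `B = 0` statements of
`FluidPDE/LerayProfileCalculus` and `FluidPDE/TsaiHeadPressure`: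

* `inner_clm_left_eq_neg_of_skew`, `traceCLM_eq_zero_of_skew`: `⟪Bx, z⟫ = −⟪x, Bz⟫`, `tr B = 0`
  for skew `B` (`⟪Bx, x⟫ = 0`);
* `divergence_clm_apply_eq`, `divergence_fderiv_apply_clm_eq`,
  `divergence_rotationTerm_eq_zero`: `div (BU) = tr (B ∘ DU)`, `div ((By·∇)U) = tr (DU ∘ B)` for
  divergence-free `U ∈ C²`, hence **`div (BU − (By·∇)U) = 0`** for EVERY linear `B` (Pineau–Vicol,
  proof of Lemma 2.1, p. 9: "`∇·(JU − (Jy·∇)U) = 0` … when `∇·U = 0`") — the pressure Poisson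
  equation is rotation-blind;
* `laplacian_pressure_eq_of_rotated`: **`ΔP = −tr (DU ∘ DU)`** (`U ∈ C³`, `P ∈ C²`);
* `contDiff_pressure_of_rotated`: `U ∈ C^∞`, `P ∈ C¹` ⇒ `P ∈ C^∞` (`∇P` is a smooth expression);
* `sum_pderiv_pderiv_pressure_of_rotated`: the Poisson equation in coordinates on `ℝ^ι`,
  `∑ₗ ∂ₗ∂ₗP = −∑ₗⱼ ∂ₗUⱼ ∂ⱼUₗ` (the input `hΔP` of `PineauVicol2026.driftOp_headPressure_forced`);
* `gradient_pressure_eq_of_rotated`: `∇P = νΔU − aU − a(y·∇)U − (BU − (By·∇)U) − (U·∇)U`.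

## References

* B. Pineau, V. Vicol, arXiv:2607.09619 (2026): (1.8) (p. 3), proof of Lemma 2.1 (p. 9).
  [PineauVicol2026]
* T.-P. Tsai, Arch. Rational Mech. Anal. 143 (1998): (1.3), (2.1) (p. 34). [Tsai1998]
-/

noncomputable section

open MeasureTheory Set Function Filter Topology InnerProductSpace Metric
open scoped RealInnerProductSpace Laplacian ContDiff BigOperators

-- the summit and its single sub-problem share the name (CONVENTIONS §1), as in every Theorems file
set_option linter.dupNamespace false

open Literature.Analysis.FluidPDE

namespace Summit.NavierStokesRegularity.NavierStokesRegularity.Theorems.CoriolisHead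

section Skew

variable {E : Type*} [NormedAddCommGroup E] [InnerProductSpace ℝ E]

/-- A skew operator (`⟪Bx, x⟫ = 0` for all `x`) satisfies `⟪Bx, z⟫ = −⟪x, Bz⟫` (polarisation).
[folklore] -/
theorem inner_clm_left_eq_neg_of_skew {B : E →L[ℝ] E} (hB : ∀ x, ⟪B x, x⟫ = 0) (x z : E) :
    ⟪B x, z⟫ = -⟪x, B z⟫ := by
  have h := hB (x + z)
  rw [map_add, inner_add_left, inner_add_right, inner_add_right, hB x, hB z,
    real_inner_comm x (B z)] at h
  linarith

/-- The trace of a skew operator on a finite-dimensional inner product space vanishes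
(`tr B = ∑ᵢ ⟪bᵢ, B bᵢ⟫` in an orthonormal basis). [folklore] -/
theorem traceCLM_eq_zero_of_skew [FiniteDimensional ℝ E] {B : E →L[ℝ] E}
    (hB : ∀ x, ⟪B x, x⟫ = 0) : traceCLM B = 0 := by
  rw [traceCLM_eq_sum_inner (stdOrthonormalBasis ℝ E)]
  exact Finset.sum_eq_zero fun i _ => by rw [real_inner_comm]; exact hB _

end Skew

section Divergence

variable {E : Type*} [NormedAddCommGroup E] [InnerProductSpace ℝ E] [FiniteDimensional ℝ E]
variable {B : E →L[ℝ] E} {U : E → E}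

/-- `div (B ∘ U)(x) = tr (B ∘ DU(x))` at a point of differentiability. [folklore] -/
theorem divergence_clm_apply_eq {x : E} (hU : DifferentiableAt ℝ U x) :
    VectorCalculus.divergence (fun y => B (U y)) x = traceCLM (B.comp (fderiv ℝ U x)) := by
  have h : HasFDerivAt (fun y => B (U y)) (B.comp (fderiv ℝ U x)) x :=
    B.hasFDerivAt.comp x hU.hasFDerivAt
  rw [divergence_eq_traceCLM, h.fderiv]

/-- `div (y ↦ DU(y)(By))(x) = tr (DU(x) ∘ B)` for a divergence-free `C²` field (the second-order
term is `D_{Bx}(div U)(x) = 0` by the symmetry of `D²U`). [folklore] -/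
theorem divergence_fderiv_apply_clm_eq (hU : ContDiff ℝ 2 U) (hdiv : VectorCalculus.IsDivFree U)
    (x : E) :
    VectorCalculus.divergence (fun y => fderiv ℝ U y (B y)) x = traceCLM ((fderiv ℝ U x).comp B) := by
  have hDUd : Differentiable ℝ (fderiv ℝ U) :=
    (hU.fderiv_right (m := 1) le_rfl).differentiable one_ne_zero
  have hdiv0 : VectorCalculus.divergence U = fun _ => (0 : ℝ) := funext hdiv
  rw [divergence_eq_traceCLM, fderiv_clm_apply (hDUd x) B.differentiableAt, map_add,
    B.fderiv]
  have hsymm : traceCLM ((fderiv ℝ (fderiv ℝ U) x).flip (B x)) =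
      fderiv ℝ (VectorCalculus.divergence U) x (B x) := by
    rw [fderiv_divergence_apply hU]
    congr 1
    ext u
    simp only [ContinuousLinearMap.flip_apply]
    exact (hU.contDiffAt.isSymmSndFDerivAt (n := 2) (by simp)) u (B x)
  rw [hsymm, hdiv0]
  simp

/-- **The rotation term is divergence free**: `div (BU − (By·∇)U) = 0` for every continuous
linear `B` and every divergence-free `C²` field `U` (`tr (B ∘ DU) = tr (DU ∘ B)`; Pineau–Vicol,
proof of Lemma 2.1: "`∇·(JU − (Jy·∇)U) = 0` … when `∇·U = 0`"). [cite: PineauVicol2026, proof of Lemma 2.1 (p. 9)] -/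
theorem divergence_rotationTerm_eq_zero (hU : ContDiff ℝ 2 U) (hdiv : VectorCalculus.IsDivFree U)
    (x : E) :
    VectorCalculus.divergence (fun y => B (U y) - fderiv ℝ U y (B y)) x = 0 := by
  have hUd : Differentiable ℝ U := hU.differentiable (by simp)
  have hDUd : Differentiable ℝ (fderiv ℝ U) :=
    (hU.fderiv_right (m := 1) le_rfl).differentiable one_ne_zero
  have hd1 : DifferentiableAt ℝ (fun y => B (U y)) x := B.differentiableAt.comp x (hUd x)
  have hd2 : DifferentiableAt ℝ (fun y => fderiv ℝ U y (B y)) x :=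
    (hDUd x).clm_apply B.differentiableAt
  rw [divergence_sub_apply hd1 hd2, divergence_clm_apply_eq (hUd x),
    divergence_fderiv_apply_clm_eq hU hdiv x, traceCLM_apply, traceCLM_apply,
    ContinuousLinearMap.toLinearMap_comp, ContinuousLinearMap.toLinearMap_comp,
    LinearMap.trace_comp_comm', sub_self]

end Divergence

section Pressure

variable {E : Type*} [NormedAddCommGroup E] [InnerProductSpace ℝ E] [FiniteDimensional ℝ E]
variable {ν a : ℝ} {B : E →L[ℝ] E} {U : E → E} {P : E → ℝ}

/-- The pressure gradient of a rotated profile, solved from the system: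
`∇P = νΔU − aU − a(y·∇)U − (BU − (By·∇)U) − (U·∇)U`. [cite: PineauVicol2026, (1.8a) (p. 3)] -/
theorem gradient_pressure_eq_of_rotated
    (heq : ∀ y, -(ν • (Δ U) y) + a • U y + a • fderiv ℝ U y y + (B (U y) - fderiv ℝ U y (B y)) +
      convect U U y + gradient P y = 0) (y : E) :
    gradient P y = ν • (Δ U) y - a • U y - a • fderiv ℝ U y y - (B (U y) - fderiv ℝ U y (B y)) -
      convect U U y := by
  have hy := heq y
  rw [← sub_eq_zero, ← hy]
  abel

/-- The rotated system in FORCED Leray form: `−νΔU + aU + a(y·∇)U + (U·∇)U + ∇P = −F` with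
`F = BU − (By·∇)U` (the shape consumed by `PineauVicol2026.driftOp_headPressure_forced`).
[cite: PineauVicol2026, (1.14a) (p. 7)] -/
theorem forced_eq_of_rotated
    (heq : ∀ y, -(ν • (Δ U) y) + a • U y + a • fderiv ℝ U y y + (B (U y) - fderiv ℝ U y (B y)) +
      convect U U y + gradient P y = 0) (y : E) :
    -(ν • (Δ U) y) + a • U y + a • fderiv ℝ U y y + convect U U y + gradient P y =
      -(B (U y) - fderiv ℝ U y (B y)) := by
  have hy := heq y
  rw [← sub_eq_zero, ← hy]
  abel

/-- **The pressure Poisson equation of a rotated profile**: `ΔP = −tr (DU ∘ DU)` — take the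
divergence of the system: `div ΔU = 0`, `div U = 0`, `div ((y·∇)U) = 0`, `div (BU − (By·∇)U) = 0`,
`div ((U·∇)U) = tr ((DU)²)`.  Needs `U ∈ C³`, `P ∈ C²`. [cite: PineauVicol2026, proof of Lemma 2.1 (p. 9)] -/
theorem laplacian_pressure_eq_of_rotated (hU3 : ContDiff ℝ 3 U) (hP2 : ContDiff ℝ 2 P)
    (hdiv : VectorCalculus.IsDivFree U)
    (heq : ∀ y, -(ν • (Δ U) y) + a • U y + a • fderiv ℝ U y y + (B (U y) - fderiv ℝ U y (B y)) +
      convect U U y + gradient P y = 0) (y : E) :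
    (Δ P) y = -traceCLM ((fderiv ℝ U y).comp (fderiv ℝ U y)) := by
  have hU2 : ContDiff ℝ 2 U := hU3.of_le (by norm_num)
  have hU1 : ContDiff ℝ 1 U := hU3.of_le (by norm_num)
  have hUd : Differentiable ℝ U := hU1.differentiable one_ne_zero
  have hDUd : Differentiable ℝ (fderiv ℝ U) :=
    (hU2.fderiv_right (m := 1) le_rfl).differentiable one_ne_zero
  have hgradP : gradient P = fun x => ν • (Δ U) x - a • U x - a • fderiv ℝ U x x -
      (B (U x) - fderiv ℝ U x (B x)) - convect U U x := funext (gradient_pressure_eq_of_rotated heq)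
  rw [← divergence_gradient hP2 y, hgradP]
  have hdA : DifferentiableAt ℝ (fun x => ν • (Δ U) x) y :=
    ((differentiable_laplacian hU3) y).const_smul ν
  have hdB : DifferentiableAt ℝ (fun x => a • U x) y := (hUd y).const_smul a
  have hdC' : DifferentiableAt ℝ (fun x => fderiv ℝ U x x) y :=
    (hDUd y).clm_apply differentiableAt_fun_id
  have hdC : DifferentiableAt ℝ (fun x => a • fderiv ℝ U x x) y := hdC'.const_smul a
  have hdR : DifferentiableAt ℝ (fun x => B (U x) - fderiv ℝ U x (B x)) y :=
    (B.differentiableAt.comp y (hUd y)).sub ((hDUd y).clm_apply B.differentiableAt)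
  have hdD : DifferentiableAt ℝ (convect U U) y := (hDUd y).clm_apply (hUd y)
  have hdAB : DifferentiableAt ℝ (fun x => ν • (Δ U) x - a • U x) y := hdA.sub hdB
  have hdABC : DifferentiableAt ℝ (fun x => ν • (Δ U) x - a • U x - a • fderiv ℝ U x x) y :=
    hdAB.sub hdC
  have hdABCR : DifferentiableAt ℝ (fun x => ν • (Δ U) x - a • U x - a • fderiv ℝ U x x -
      (B (U x) - fderiv ℝ U x (B x))) y := hdABC.sub hdR
  rw [divergence_sub_apply hdABCR hdD, divergence_sub_apply hdABC hdR,
    divergence_sub_apply hdAB hdC, divergence_sub_apply hdA hdB,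
    divergence_const_smul_apply ((differentiable_laplacian hU3) y),
    divergence_const_smul_apply (hUd y), divergence_const_smul_apply hdC',
    divergence_laplacian_eq_zero hU3 hdiv, hdiv y,
    divergence_fderiv_apply_self_eq_zero hU2 hdiv, divergence_rotationTerm_eq_zero hU2 hdiv,
    divergence_convect_self_eq hU2 hdiv]
  ring

/-- **The pressure of a smooth-velocity rotated profile is smooth**: by the system, `∇P` is a
smooth expression in `U` and its derivatives, so `P ∈ C¹` upgrades to `P ∈ C^∞`
(Tsai 1998, p. 34: "Since `U` is smooth, `P` is also smooth"). [cite: Tsai1998, §2 (p. 34)] -/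
theorem contDiff_pressure_of_rotated (hU : ContDiff ℝ ∞ U) (hP : ContDiff ℝ 1 P)
    (heq : ∀ y, -(ν • (Δ U) y) + a • U y + a • fderiv ℝ U y y + (B (U y) - fderiv ℝ U y (B y)) +
      convect U U y + gradient P y = 0) : ContDiff ℝ ∞ P := by
  have hDU : ContDiff ℝ ∞ (fderiv ℝ U) := hU.fderiv_right (m := ∞) le_rfl
  have hΔ : ContDiff ℝ ∞ (Δ U) := contDiff_laplacian (n := (⊤ : ℕ∞)) (by exact hU)
  have hG : ContDiff ℝ ∞ fun x => ν • (Δ U) x - a • U x - a • fderiv ℝ U x x -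
      (B (U x) - fderiv ℝ U x (B x)) - convect U U x := by
    have hA : ContDiff ℝ ∞ fun x => ν • (Δ U) x := contDiff_const.smul hΔ
    have hB' : ContDiff ℝ ∞ fun x => a • U x := contDiff_const.smul hU
    have hC : ContDiff ℝ ∞ fun x => a • fderiv ℝ U x x :=
      contDiff_const.smul (hDU.clm_apply contDiff_id)
    have hR : ContDiff ℝ ∞ fun x => B (U x) - fderiv ℝ U x (B x) :=
      (B.contDiff.comp hU).sub (hDU.clm_apply B.contDiff)
    have hD : ContDiff ℝ ∞ (convect U U) := hDU.clm_apply hU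
    exact (((hA.sub hB').sub hC).sub hR).sub hD
  have hgradP : gradient P = fun x => ν • (Δ U) x - a • U x - a • fderiv ℝ U x x -
      (B (U x) - fderiv ℝ U x (B x)) - convect U U x := funext (gradient_pressure_eq_of_rotated heq)
  have hfd : fderiv ℝ P = fun x => InnerProductSpace.toDual ℝ E (gradient P x) := by
    funext x
    simp [gradient]
  rw [contDiff_infty_iff_fderiv, hfd, hgradP]
  exact ⟨hP.differentiable one_ne_zero, (InnerProductSpace.toDual ℝ E).contDiff.comp hG⟩

end Pressure

section Coord

variable {ι : Type*} [Fintype ι] [DecidableEq ι]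
variable {ν a : ℝ} {B : EuclideanSpace ℝ ι →L[ℝ] EuclideanSpace ℝ ι}
  {U : EuclideanSpace ℝ ι → EuclideanSpace ℝ ι} {P : EuclideanSpace ℝ ι → ℝ}

/-- **Pressure Poisson equation of a rotated profile, coordinate form** on `ℝ^ι`:
`∑ₗ ∂ₗ∂ₗP = −∑ₗⱼ ∂ₗUⱼ ∂ⱼUₗ` for `U ∈ C^∞`, `P ∈ C²` (from `laplacian_pressure_eq_of_rotated`,
`Δ = ∑ₗ ∂ₗ∂ₗ` and `tr ((DU)²) = ∑ₗⱼ ∂ₗUⱼ ∂ⱼUₗ`). [cite: PineauVicol2026, proof of Lemma 2.1 (p. 9)] -/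
theorem sum_pderiv_pderiv_pressure_of_rotated (hU : ContDiff ℝ ∞ U) (hP2 : ContDiff ℝ 2 P)
    (hdiv : VectorCalculus.IsDivFree U)
    (heq : ∀ y, -(ν • (Δ U) y) + a • U y + a • fderiv ℝ U y y + (B (U y) - fderiv ℝ U y (B y)) +
      convect U U y + gradient P y = 0) (y : EuclideanSpace ℝ ι) :
    ∑ l, pderiv l (pderiv l P) y =
      -∑ l, ∑ j, pderiv l (fun z => U z j) y * pderiv j (fun z => U z l) y := by
  have hU3 : ContDiff ℝ 3 U := hU.of_le (by norm_cast)
  have hdiff : DifferentiableAt ℝ U y := (hU.differentiable (by simp)) y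
  rw [← laplacian_eq_sum_pderiv_pderiv' hP2 y, laplacian_pressure_eq_of_rotated hU3 hP2 hdiv heq y,
    traceCLM_comp_self_eq_sum_sum (EuclideanSpace.basisFun ι ℝ)]
  congr 1
  refine Finset.sum_congr rfl fun l _ => Finset.sum_congr rfl fun j _ => ?_
  have hb : ∀ k, (EuclideanSpace.basisFun ι ℝ) k = (stdVec k : EuclideanSpace ℝ ι) := fun k => by
    simp [stdVec, EuclideanSpace.basisFun_apply]
  rw [EuclideanSpace.basisFun_inner, EuclideanSpace.basisFun_inner, hb, hb, pderiv_apply,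
    pderiv_apply, ← euclidean_fderiv_apply_comp hdiff, ← euclidean_fderiv_apply_comp hdiff, mul_comm]

end Coord

end Summit.NavierStokesRegularity.NavierStokesRegularity.Theorems.CoriolisHead

end
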